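import Literature.NumberTheory.EllipticCurves.JetchevSkinnerWan2017.AnticyclotomicControlGeneral
import Literature.NumberTheory.EllipticCurves.Castella2018.AnticyclotomicControlTheorem
import HarnessLib

/-!
# Jetchev–Skinner–Wan 2017, Thm. 3.3.1 with Prop. 3.2.1, §3.3.3 and §3.5 (3.5.c): the ANTICYCLOTOMIC
# CONTROL THEOREM for an elliptic curve over `ℚ` at a prime `p ≥ 3` of MULTIPLICATIVE reduction split
# in `K` — ANY conductor (no semistability), general imaginary quadratic `K`, `Σ = ∅`, on the
# Literature object `X_ac`; JSW's local index at `p ∣ N` evaluated as in Castella 2018, proof of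
# Thm. 2.3, (eq:calcul)

HONEST FRAMING (cell `bsd-stepL`, run/shared/lean/pub/bsd-stepL/, rung K2 of LADDER-BSD; verbatim in
every file): BSD is NOT proved by any of this; a closed item closes a rung leaf, never summit credit.
The cell types the objects of the residual classes of the `p`-part of the Birch–Swinnerton-Dyer
formula in analytic rank one at a multiplicative prime `p ∥ N` and assembles class theorems STRICTLY
from published theorems; construction-shaped inputs are TYPED (missing-input `Prop`s), not attempted;
an unrefereed result enters only as an explicitly labelled open hypothesis. This file vendors ONE
published statement as a named fact (`def … : Prop`, nothing asserted; D-0014/D-0026) and PROVES its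
bookkeeping consumers. Unit `bsd-stepL-imc-t1` (literature typer, D-0074 hand, session g5), answering
the TYPER ASK of seat `bsd-stepL-imc-p1` (HOME/STATUS.md 2026-08-26T05:34:26Z): "JSW17 Thm 3.3.1 +
(3.5.d) at `p ∥ N` for any `E` (Cas18 Thm 2.3 without «semistable», which the erratum's A′ itself
uses on non-semistable `E`)".

## What and why

The control IDENTITY of the cell's route p2 / crux `OpenInputIMC` (item 19061, child 19274
`OpenInputRamOffErratumLocus` of `Summits/BirchSwinnertonDyer/BirchSwinnertonDyer/Theses/ErratumRoadFive.lean`)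
is the Summits shape `X11b.ControlOnTreeAt p κ 𝔭 γ ι P` / `X11b.P2ControlOnTreeAt W p`. Today it is
fed (i) on the Locus `p ∤ ∏_ℓ c_ℓ(E)` by the cell's own theorem from cited cohomological facts
(`X11b/Three/ControlIdentityLocus.lean`), and (ii) on SEMISTABLE pairs by Castella 2018 Thm. 2.3
(`Castella2018.thm23_anticyclotomicControl`, whose binder `Semistable W` transcribes the paper's
standing hypothesis §2.1 "Let `E/ℚ` be a semistable elliptic curve"). Off the Locus on a
NON-semistable curve (`p ∣ ∏c`, some additive prime; 34 474 class-wide pairs at `p ≥ 5` by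
imc-p1's census of 2026-08-26) nothing published fed the shape. But the theorem IS in refereed print
for every conductor: Castella's Thm. 2.3 is, by its own proof ("this follows easily from the
'Anticyclotomic Control Theorem' established in [JSW]"), Jetchev–Skinner–Wan's Thm. 3.3.1 +
Prop. 3.2.1 + §3.5, which are stated and proved for a newform of ANY level `N` with `ord_p(N) ≤ 1`
((p-sst), p. 15) — the local Galois representation at `p` being semistable, NOT the curve —, under
(irred_𝒦) "`E[p]` is an irreducible `G_𝒦`-representation" in place of Castella's "semistable, `p ≥ 5`,
`ρ̄_{E,p}` irreducible" (which imply (irred_𝒦): `ρ̄_{E,p}` is then surjective [Serre, Mazur]). The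
one step of Castella's proof at `p ∣ N` that is not a citation of [JSW] is the evaluation of JSW's
local index `δ_v = [E(K_𝔭)_{/tors} ⊗ ℤ_p : ℤ_p.P]` ((eq:calcul), p. 6) — a computation inside
`E(K_𝔭) = E(ℚ_p)` by the filtration `E ⊃ E₀ ⊃ E₁ ≅ pℤ_p` of a curve with multiplicative reduction
at `p`, "trivial by e.g. [silverman-2] (and `p > 2`)", which does not see the other primes of `N`.
The author himself applies Thm. 2.3 to non-semistable `E` in the erratum (Thm. A′ "does not require
the `E` to be semistable", proved by "the same argument as in [Cas18, §5]", and §5 is Thm. 2.3 +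
Thm. 3.2 + the main conjecture). The GOOD-`p` companion for any conductor is already in the tree:
`thm331_anticyclotomicControl_general` (`3 ≤ p`, `Good W p`, (irred_𝒦); this directory). This file
adds the MULTIPLICATIVE-`p` statement with the SAME binders, so that the two together are exactly
"Castella 2018 Thm. 2.3 (both `ε_p`, `Σ = ∅`) with (irred_𝒦) in place of semistability"
(`anticyclotomicControl_of_general_of_mult`, PROVED below). Consumer (Summits side, prover seat
imc-p1): `controlOnTreeAt_of_thm331Mult[_embAt]`, `p2ControlOnTreeAt_of_thm331Mult` — the analogues
of `X11b/RouteR1ControlCastella.lean`'s `controlOnTreeAt_of_thm23[_embAt]` and of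
`X11b/BDPRouteOpenInputFromLever.lean`'s `p2ControlOnTreeAt_of_thm23_of_semistable` with `hsst`,
`hirr` replaced by `hIrrK` ((irred_𝒦) is a tree THEOREM on the (ram) atom:
`Partition/IrreducibleOverQuadraticField.lean` `irrK_of_surj` with `X11.surj_of_irr_of_ram`).

## Citation header (read by this seat, 2026-08-26, on the store's LaTeXML text of arXiv:1512.06894 =
## the accepted manuscript of the version of record — `paper:arxiv-1512.06894`, chunks p0010 L1–L98,
## p0011 L1–L60, p0012 L40–L110, p0015 L7–L125 — and of arXiv:1704.06608 — `paper:arxiv-1704.06608`,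
## chunks p0005 L110–L160, p0006 L1–L50; arXiv theorem numbers in brackets)

* Authors: Dimitar Jetchev, Christopher Skinner, Xin Wan. Title: *The Birch and Swinnerton-Dyer
  formula for elliptic curves of analytic rank one*. Venue: Camb. J. Math. **5** (2017), no. 3,
  369–434, doi:10.4310/CJM.2017.v5.n3.a2 (= arXiv:1512.06894; bib key `JetchevSkinnerWan2017`).
  REFEREED / PUBLISHED.
* Setting (verbatim). §2.1 (p. 6): "Throughout, let `p ≥ 3` be a fixed prime". §3 (p. 10 L1–L27):
  "Let `𝒦/ℚ` be an imaginary quadratic field such that `p` splits in `𝒦`: `p = v v̄` (split). … Let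
  `𝒦_∞` be the anticyclotomic `ℤ_p`-extension of `𝒦` and let `Γ = Gal(𝒦_∞/𝒦)`. Let `(V,T,W)` … be
  as in Section 2.1. Let `Λ = 𝒪⟦Γ⟧` and put `M = T ⊗_𝒪 Λ^`, `Λ^ = Hom_cont(Λ, ℚ_p/ℤ_p)`. We equip
  `M` with an action of `G_𝒦` via `ρ ⊗ Ψ⁻¹` … Given a finite set `Σ` of finite places `w ∤ p`, let
  `X_ac^Σ(M) = Hom_𝒪(H¹_{𝓕_ac^Σ}(𝒦, M), L/𝒪)`." — NO hypothesis on the level away from `p`.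
* **§3.1 "A few assumptions on `(V,T,W)`"** (p. 10 L40–L95, verbatim): "In addition to (geom) and
  (pure) we will assume that (sst) `V` is semistable as a representation of `G_{𝒦_w}` for all
  `w ∣ p` and that (τ-dual) `V* ≅ V^τ` … (2-dim) `dim_L V = 2`, (HT) no non-zero Hodge–Tate weight of
  `V` is `≡ 0 (mod p−1)`, and that (irred_𝒦) `V̄` is an irreducible `κ`-representation of `G_𝒦`. We
  assume furthermore that (corank 1) `H¹_{𝓕_BK}(𝒦, W)_div ≅ L/𝒪` and `H¹_f(𝒦_w, W) ≅ L/𝒪`, `w ∣ p`,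
  and (sur) `H¹_{𝓕_BK}(𝒦, W)_div ↠ H¹_f(𝒦_w, W)`, `w ∣ p`." — (sst) is a LOCAL condition at `p`.
* **Prop. 3.2.1** [arXiv Prop. 6] (p. 10 L100–L106, verbatim): "One has `#H¹_{𝓕_ac}(𝒦, W) =
  #Ш_BK(W/𝒦) · (#δ_v)²`, where `δ_v = coker{H¹_{𝓕_BK}(𝒦, T) →^{loc_v} H¹_f(𝒦_v, T)/H¹(𝒦_v, T)_tor}`.
  In particular, `H¹_{𝓕_ac}(𝒦, W)` has finite order." **Remark 3.2.2** [arXiv Rem. 7] (p. 11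
  L17–L22, verbatim): "(a) Note that neither of the assumptions (sst) and (HT) is used in this proof.
  (b) Clearly, (irred_𝒦) is not essential to the proof of the finiteness … Under certain
  circumstances, such as if `T = T_𝔭 A_f`, we have `W* ≅ T^τ` without assuming (irred_𝒦)."
* **Thm. 3.3.1** [arXiv Thm. 8] (p. 11 L24–L44, verbatim): "Let `S` be a finite set of places of `𝒦`
  including all those at which `V` is ramified and let `S_p ⊂ S` be the subset of those not dividing
  `p`. Let `Σ ⊂ S_p`. Fix a topological generator `γ ∈ Γ`. We identify `𝒪⟦T⟧` with `Λ = 𝒪⟦Γ⟧` via the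
  continuous `𝒪`-algebra map sending `1 + T ↦ γ`. … **Theorem 3.3.1** (Anticyclotomic Control
  Theorem). The `Λ`-module `X_ac^Σ(M)` is `Λ`-torsion, and if `f_ac^Σ(T)` is a generator of its
  characteristic `Λ`-ideal `Ch(X_ac^Σ(M))`, then `#𝒪/f_ac^Σ(0) = #H¹_{𝓕_ac}(𝒦, W) · C^Σ(W)`, where
  `C^Σ(W) = #H⁰(𝒦_v, W) · #H⁰(𝒦_v̄, W) · ∏_{w ∈ S_p∖Σ, w split} #H¹_ur(𝒦_w, W) · ∏_{w∈Σ} #H¹(𝒦_w, W)`."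
* **§3.3.3** [arXiv Prop. 11] (p. 12 L50–L100, verbatim): "`c_w^{(p)}(W) := [H¹_ur(𝒦_w, W) :
  H¹_f(K_w, W)] = #H¹_ur(𝒦_w, W)` are the `p`-parts of the local Tamagawa numbers"; Case 1(a)
  (`w ∤ p` ramified, `ℓ` split): "the order of the latter is exactly the `p`-part `c_w^{(p)}(W)` of the
  Tamagawa number at `w`"; Case 1(b) (`w ∤ p`, `ℓ` not split): "`ker(r_w) = 0`"; Case 2(a) (`w ∤ p`
  unramified, `ℓ` split): "trivial since the two local conditions coincide". So at `Σ = ∅` the product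
  in `C^∅(W)` is `∏ c_w^{(p)}(E/𝒦)` over the places `w ∤ p` of `𝒦` above the primes `ℓ ∣ N`, `ℓ ≠ p`,
  that SPLIT in `𝒦` — at `p ∣ N` the two places above `p` are NOT in `S_p`.
* **§3.5** (p. 15 L7–L117, verbatim): "Let `f ∈ S_{2k}(Γ₀(N))` be a newform … It is a theorem of
  Saito … that `V` is geometric and pure of weight `−1`. So (geom), (pure), (τ-dual), and (2-dim) all
  hold for `V`. Furthermore, it follows that if **(p-sst) `ord_p(N) ≤ 1`**, then `V` is semistable at
  `p`, that is, (sst) also holds. … in particular, (HT) always holds for `2k = 2`. Suppose now that `f`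
  has weight `2` and that `(V,T,W) = (V_𝔭 A_f, T_𝔭 A_f, A_f[𝔭^∞])` … Suppose (rank 1) … Suppose
  (Ш 𝔭-finite) `#Ш(A_f/𝒦)[𝔭^∞] < ∞`. Note that is this case `Ш_BK(W_f/𝒦) = Ш(A_f/𝒦)[𝔭^∞]`. Under
  the assumptions (rank 1) and (Ш-finite), it follows … that (crk 1) holds … If furthermore (𝔭-irred)
  `A_f[𝔭]` is an irreducible `G_𝒦`-representation, then `A_f(𝒦) ⊗_{ℤ(f)} 𝒪 ≅ H¹_f(𝒦,T) ≅ 𝒪`. …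
  That is, (surj_p) also holds. This shows that if (split), (rank 1), (Ш-finite), and (𝔭-irred) hold,
  then so do (crk 1), (surj_p), and (irred_𝒦). … `#δ_v = [A_f(𝒦_v)_{/tor} ⊗_{ℤ(f)⊗ℤ_p} 𝒪 : 𝒪·P] /
  [A_f(𝒦) ⊗_{ℤ(f)} 𝒪 : 𝒪·P]`. In particular, it then follows from Proposition 3.2.1 that
  **(3.5.c)** `#H¹_{𝓕_ac}(𝒦, W_f) = #Ш_BK(W_f/𝒦) · [A_f(𝒦_v)_{/tor} ⊗_{ℤ(f)⊗ℤ_p} 𝒪 : 𝒪·P]² /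
  [A_f(𝒦) ⊗_{ℤ(f)} 𝒪 : 𝒪·P]²`. Suppose now that (good) `p ∤ N`. …" — everything up to and
  including (3.5.c) is derived under (p-sst), i.e. ALSO at a multiplicative `p ∥ N`; only the
  subsequent evaluation of the local index, display (3.5.d) "`#ℤ_p/((1−a_p+p)/p · log_{ω_E} P) /
  ([E(𝒦):ℤ·P]_p · #H⁰(𝒦_v, E[p^∞]))`", uses (good). [The label (3.5.c) is this seat's name for the
  unnumbered display preceding "(good)"; the tree's A174/A178 call the next one (3.5.d).]
* **The local index at a multiplicative `p`** — F. Castella, *On the `p`-part of the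
  Birch–Swinnerton-Dyer formula for multiplicative primes*, Camb. J. Math. **6** (2018) 1–23
  (= arXiv:1704.06608; `Castella2018`; REFEREED; Thm. 2.3 is NOT withdrawn by the author's erratum,
  which replaces Thm. 4.4 / Thm. A only), proof of Thm. 2.3, pp. 5–6 (chunk p0005 L110–L160, p0006
  L1–L50), verbatim: "this follows easily from the 'Anticyclotomic Control Theorem' established in
  [JSW]. The hypotheses imply that `corank_{ℤ_p} Sel(K, E[p^∞]) = 1` and that the natural map
  `E(K) ⊗ ℚ_p/ℤ_p → E(K_w) ⊗ ℚ_p/ℤ_p` is surjective for all `w ∣ p`. By [JSW] … (eq:321)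
  `#H¹_ac(K, E[p^∞]) = #Ш(E/K)[p^∞] · [E(K_𝔭)_{/tors} ⊗ ℤ_p : ℤ_p.P]² / [E(K) ⊗ ℤ_p : ℤ_p.P]²` …
  Suppose now that `p ∣ N`. Let `Ẽ_ns(𝔽_p)` be the group on nonsingular points on the reduction of
  `E` modulo `p`, `E₀(K_𝔭)` be the inverse image of `Ẽ_ns(𝔽_p)` under the reduction map, and
  `E₁(K_𝔭)` be defined by the exactness of (eq:red-p) `0 → E₁(K_𝔭) → E₀(K_𝔭) → Ẽ_ns(𝔽_p) → 0`. The
  formal group logarithm defines an injective homomorphism `log_{ω_E} : E(K_𝔭)_{/tor} ⊗ ℤ_p → ℤ_p`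
  mapping `E₁(K_𝔭)` isomorphically onto `pℤ_p`, and hence … `E₀(K_𝔭)/E₁(K_𝔭) ⊗ ℤ_p ≃ Ẽ_ns(𝔽_p)
  ⊗ ℤ_p`, which is trivial by e.g. [silverman-2] (and `p > 2`). Since clearly `E(K_𝔭)_tors ⊗ ℤ_p =
  H⁰(K_𝔭, E[p^∞])`, we thus conclude that (eq:calcul) `[E(K_𝔭)_{/tors} ⊗ ℤ_p : ℤ_p.P] =
  [E(K_𝔭):E₀(K_𝔭)]_p · #ℤ/(p⁻¹ log_{ω_E} P) / #H⁰(K_𝔭, E[p^∞])` … Plugging this formula … into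
  [JSW] yields the equality (eq:control-p) `#ℤ_p/f_ac^Σ(0) = #Ш(E/K)[p^∞] · (#ℤ_p/(p⁻¹ log_{ω_E} P)
  / [E(K) ⊗ ℤ_p : ℤ_p.P])² · [E(K_𝔭):E₀(K_𝔭)]_p² × ∏_{w ∈ S∖Σ, w∤p split} #H¹_ur(K_w, E[p^∞]) ·
  ∏_{w∈Σ} …`, where `S` is any finite set of places of `K` containing `Σ` and the primes above `N`.
  Now, if `w ∣ p`, then (eq:tam-p) `[E(K_𝔭):E₀(K_𝔭)]_p = c_w^{(p)}(E/K)` by definition, while if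
  `w ∤ p`, then (eq:tam-not-p) `#H¹_ur(K_w, E[p^∞]) = c_w^{(p)}(E/K)` by [skinner-zhang]. Since
  `c_w^{(p)}(E/K) = 1` unless `w ∣ N`, … the proof … follows." The statement proved (Thm. 2.3, p. 5
  L93–L109, case `p ∣ N`, `Σ = ∅`): "`#ℤ_p/f_ac(0) = #Ш(E/K)[p^∞] · (#ℤ_p/((1 − a_p p⁻¹) log_{ω_E} P)
  / [E(K) ⊗ ℤ_p : ℤ_p.P])² × ∏_{w∣N⁺} c_w^{(p)}(E/K)`", `N⁺` "the product of the prime factors of `N`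
  which are split in `K`" (§2.2) — at `p ∣ N` split in `K` the two places above `p` are among the
  `w ∣ N⁺`; "`a_p ∈ {±1}`" (p. 4 L35–L36), so `ord_p(1 − a_p p⁻¹) = −1`. The paper's standing
  hypotheses (§2.1, p. 5 L5–L14: "`E/ℚ` semistable … `p ≥ 5` … `ρ̄_{E,p}` irreducible") are not
  invoked in this computation, which lives in `E(ℚ_p)`; they enter the printed proof only through
  "[JSW]" = (irred_𝒦) (semistable + `p ≥ 5` + irreducible ⇒ `ρ̄_{E,p}` surjective ⇒ irreducible on
  `G_K`; cf. flag `Cas18-Thm23-by-reference` of `Castella2018/AnticyclotomicControlTheorem.lean`).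
* F. Castella, *Erratum to "On the `p`-part …"*, 5 pp., author's web page, n.d.
  (`Castella2018Erratum`, UNREFEREED; cell dossier HOME/LIT-DOSSIER.md §2.2), p. 1: "Using Theorem 1.1
  in place of [Cas18, Thm. 4.4], the same argument as in [Cas18, §5] yields the following result"
  = Thm. A′ for "an elliptic curve of conductor `N` with multiplicative reduction at `p > 3`" with no
  semistability; pp. 1–2: "Compared to Theorem A of [Cas18] … Theorem A′ … does not require the `E`
  to be semistable" — i.e. the author applies Thm. 2.3 (the first step of §5) to non-semistable `E`.
  (Recorded as corroboration only; the statement below rests on the refereed [JSW] + the local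
  computation, not on the erratum.)

## Transcription (tree vocabulary; every symbol a Literature object — IDENTICAL to the dictionary of
## `thm331_anticyclotomicControl_general` (good `p`) and of `thm23_anticyclotomicControl` (case `p ∣ N`))

* "`E/ℚ` of conductor `N`, `p ≥ 3`, (p-sst) at a `p ∣ N`" = a globally minimal `W`, `3 ≤ p`,
  `Rank1Residual.Mult W p` (`W.HasMultiplicativeReductionAtPrime p`, i.e. `ord_p(N) = 1`). NO
  `Semistable W`: nothing is assumed at the primes `ℓ ≠ p`.
* "`𝒦` imaginary quadratic, `p = v v̄` splits" = `IsImaginaryQuadratic K`,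
  `SatisfiesHeegnerHypothesis p K`; NOTHING assumed about the primes of `N` in `K` (Castella §5 and
  the cell's erratum data use `K` with `q ∣ N` RAMIFIED).
* (irred_𝒦) = `(W.baseChange K).HasIrreducibleModPGaloisRep p` — an explicit binder, as in
  `thm331_anticyclotomicControl_general` (in print ⇐ (irr) over `ℚ` + `ρ̄_{E,p}` ramified at some
  `q ∥ N`, JSW §7.4.1 p. 30 / Skinner 2020 Lem. 2.8.1; a tree theorem from surjectivity,
  `irrK_of_surj`).
* "`v` the STRICT prime, `log_{ω_E}` on `E(𝒦_v) = E(ℚ_p)`" = an embedding `ι : K →+* ℚ_p` and the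
  prime `v` it induces (`x ∈ v ⟺ ‖ι x‖ < 1` on `𝓞 K`); `ord_p log_{ω_E} P = padicLogOrd W p ι P`
  (`PadicFormalLogOrder.lean`: Néron differential of the minimal model, the `ℤ_p`-linear extension
  `log(m₀P)/m₀` — exactly Castella's "`log_{ω_E} : E(K_𝔭)_{/tor} ⊗ ℤ_p → ℤ_p` mapping `E₁(K_𝔭)`
  isomorphically onto `pℤ_p`").
* "`𝒦_∞`, `γ`, `Λ = 𝒪⟦T⟧`, `1 + T ↦ γ`" = an anticyclotomic `κ : ZpExtension K p`, a topological
  generator `γ` (`[Fact (κ.IsTopGenerator γ)]`), `IwasawaAlgebra p`; "`X_ac(M) = X_ac^∅(M)`" =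
  `AcSelmer.XAc (W.baseChange K) p κ v ∅ γ` (Castella 2018 Def. 2.2's `X_ac(E[p^∞])`, strict at
  `𝔭 = v`, `K_∞`-formulation; reading flag `JSW-331-Kinf-formulation` travels unchanged from
  A174/A178: JSW's "`0`" at `v` and at non-split `w ∤ p` IS the tree's strict condition, JSW's
  "`H¹_ur`" at split `w ∤ p` equals "locally trivial" over `K_∞`).
* "`rank_ℤ E(𝒦) = 1`", "`#Ш(E/𝒦)[p^∞] < ∞`", "`P` of infinite order", "`[E(𝒦) ⊗ ℤ_p : ℤ_p·P]`" =
  `(W.baseChange K).mordellWeilRank = 1`, `Finite (primaryComponent (W.baseChange K).sha p)`,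
  `¬ IsOfFinAddOrder P`, `p^{ord_p [E(K) : ℤ·P]}` (`(AddSubgroup.zmultiples P).index`; `E(K)[p] = 0`
  under (irred_𝒦), so the `p`-parts agree).
* **The local term, in valuations, at `Σ = ∅`.** JSW: `ord_p f_ac(0) = ord_p #Ш[p^∞] + 2·(ord_p δ_v)
  + ord_p(#H⁰(𝒦_v, W)·#H⁰(𝒦_v̄, W)) + Σ_{w ∈ S_p split} ord_p c_w(E/𝒦)` with (3.5.c) `ord_p δ_v =
  ord_p [E(𝒦_v)_{/tor} ⊗ ℤ_p : ℤ_p·P] − ord_p [E(𝒦):ℤ·P]`; Castella (eq:calcul): `ord_p [E(𝒦_v)_{/tor}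
  ⊗ ℤ_p : ℤ_p·P] = ord_p c_v(E/𝒦) + (ord_p log_{ω_E} P − 1) − ord_p #H⁰(𝒦_v, E[p^∞])`; `𝒦_v = 𝒦_v̄ =
  ℚ_p`, so `#H⁰(𝒦_v, W) = #H⁰(𝒦_v̄, W)` cancel against the two `−ord_p #H⁰` and `2·ord_p c_v =
  ord_p(c_v c_v̄)` joins the Tamagawa sum ((eq:tam-p)): `ord_p f_ac(0) = ord_p #Ш(E/𝒦)[p^∞] +
  2·((ord_p log_{ω_E} P − 1) − ord_p [E(𝒦):ℤ·P]) + ord_p ∏_{w ∣ N, w split in 𝒦} c_w(E/𝒦)`, the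
  product INCLUDING the two places above `p` = `splitTamagawaProduct W K` (this directory; same body
  as the Summits twin `X11b.tamagawaProductSplit`). This is LITERALLY the conclusion of
  `thm23_anticyclotomicControl` in the case `p ∣ N` (`thm23_anticyclotomicControl_mult`) and the body
  shape of the cell's `X11b.ControlOnTreeAt` ("`ord_p(1 − a_p p⁻¹) = −1`").
* Conclusion, with `#ℤ_p/(x) = p^{ord_p x}`: `X_ac` is `Λ`-torsion, `Ch = (f)` for some `f` with
  `f(0) ≠ 0`, and `ord_p f(0) = ord_p #Ш(E/𝒦)[p^∞] + 2·((ord_p log_{ω_E} P − 1) − ord_p[E(𝒦):ℤ·P]) +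
  ord_p (splitTamagawaProduct W K)` (for ANY generator: `thm331_mult_padicVal_eq_of_generator`).
* `Σ = ∅` only; `p ≥ 3` as printed by JSW (§2.1) and used by the local computation ("`p > 2`").
  `-- TODO(general form): the Σ-imprimitive statement (extra factor ∏_{w∈Σ} #H¹(K_w, E[p^∞])) and
  the modular-abelian-variety version (A_f, 𝒪 = ℤ(f)_𝔭) have no consumer in the cell.`

Flags offered to the referee: `JSW331-mult-local-index` — the E-arithmetic evaluation of JSW's
`δ_v` at a multiplicative `p` is printed inside Castella's proof of Thm. 2.3 (pp. 5–6), a paper whose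
§2.1 standing hypotheses say "semistable, `p ≥ 5`"; the computation uses only "`E` has multiplicative
reduction at `p`" and "`p > 2`" (it is the filtration `E(ℚ_p) ⊃ E₀ ⊃ E₁ ≅ pℤ_p` with `#Ẽ_ns(𝔽_p) =
p ∓ 1` prime to `p` [Silverman AEC IV.6.4(b), VII.2.1–2.2, VII.6.1]), and the cell has independently
PROVED the same local index for EVERY `W` with `Mult W p` on the tree's objects
(`Summit.BirchSwinnertonDyer.Rank1Residual.X11b.index_range_nsmul_sup_zmultiples_padicPointOf_of_mult`,
`X11b/BDPRouteLocalIndex.lean`; torsion allowed: `X11b/BDPRouteLocalIndexTorsion.lean`) — so the flag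
concerns the locator of one elementary step, not the statement; `JSW-331-Kinf-formulation` (as for
A174/A178, moot here since the object is Castella's own Def. 2.2).

Presearch (required line): `presearch: "anticyclotomic control theorem at a multiplicative p for a
non-semistable E" → [corpus:arxiv-1512.06894 p0010–p0012, p0015] JSW Thm 3.3.1 + Prop 3.2.1 + §3.3.3
+ (3.5.c) at ord_p N ≤ 1, any N (THE source); [corpus:arxiv-1704.06608 p0005–p0006] the local index at
p ∣ N; [corpus:arxiv-2402.12781 p0029–p0030] Keller–Yin App. B "anticyclotomic control theorem which
allows torsion" (PRE; reducible setting; E-formula printed at good p only); [corpus:arxiv-2409.01360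
p0008–p0009] Castella 2024 §3.2 only a Mazur-type control (Thm 3.4); [corpus:arxiv-1405.7294 p0003]
Skinner 2020 converse at p ∤ N; [corpus:arxiv-2405.00270 p0004] BCS 2024 cite JSW 3.3.1 at good p; lit
search --hybrid "anticyclotomic control theorem multiplicative reduction Selmer characteristic ideal
Tamagawa" → Silverman ATAEC / Delbourgo 2008 / Coates 1999 pages, no restatement; lit vsearch (papers)
→ nothing relevant; galaxy --star all "anticyclotomic control theorem|Anticyclotomic Control Theorem"
→ 0 rows; galaxy --star pdf "multiplicative primes|multiplicative reduction at p" → 12 generic rows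
(lecture notes, theses), no restatement. No other printed E-arithmetic control formula at p ∥ N.`

## Contents

* `thm331_anticyclotomicControl_mult` — the named fact (ONE new `def … : Prop`; nothing asserted).
* PROVED: `hasCharValuationAt_of_thm331_mult` (packaged currency `AcSelmer.XAc.HasCharValuationAt`,
  literally the body shape of the cell's `X11b.ControlOnTreeAt`), `thm331_mult_padicVal_eq_of_generator`
  (generator independence), `anticyclotomicControl_of_general_of_mult` (Castella 2018 Thm. 2.3's
  TWO-CASE statement at `Σ = ∅` — the exact conclusion of `thm23_anticyclotomicControl` — for ANY
  conductor at `p ≥ 3` under (irred_𝒦), from `thm331_anticyclotomicControl_general` ∧ this fact),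
  `thm23_conclusion_mult_of_thm331_mult` (the multiplicative case of Castella's Thm. 2.3 at any of its
  data follows from this fact once (irred_𝒦) is supplied — the subsumption, for consumers written
  against `thm23`'s binders).

## References
* [JetchevSkinnerWan2017] Camb. J. Math. 5 (2017) = arXiv:1512.06894: §2.1 (p. 6 "`p ≥ 3`"), §3
  (p. 10, setting), §3.1 (p. 10, assumptions), Prop. 3.2.1 [arXiv Prop. 6] and Remark 3.2.2 [arXiv
  Rem. 7] (pp. 10–11), Thm. 3.3.1 [arXiv Thm. 8] (p. 11), §3.3.3 [arXiv Prop. 11, Cases 1(a), 1(b),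
  2(a)] (p. 12), §3.5 (p. 15: (p-sst), (rank 1), (Ш 𝔭-finite), (𝔭-irred), display (3.5.c); p. 16:
  (good), (3.5.d)), §7.4.1 (p. 30, (irred_𝒦) from (irr) + ramified `q ∥ N`).
* [Castella2018] Camb. J. Math. 6 (2018) = arXiv:1704.06608: §2.1–§2.2 and Def. 2.2 (p. 5), Thm. 2.3
  (p. 5) and its proof (pp. 5–6: (eq:321), (eq:red-p), (eq:calcul), (eq:control-p), (eq:tam-p),
  (eq:tam-not-p)), p. 4 ("`a_p ∈ {±1}`"); Literature `Castella2018/AnticyclotomicControlTheorem.lean`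
  (`thm23_anticyclotomicControl`, the semistable transcription) and `AnticyclotomicSelmer{,Dual}.lean`
  (the object `X_ac`).
* [Castella2018Erratum] F. Castella, Erratum (web PDF, n.d.): p. 1 Thm. A′ and "the same argument as
  in [Cas18, §5]"; pp. 1–2 remark (2) "does not require the `E` to be semistable". UNREFEREED;
  corroboration only.
* [SilvermanAEC2009] IV.6.4(b), VII.2.1–2.2, VII.6.1 (the filtration used in (eq:calcul)).
* Tree: `JetchevSkinnerWan2017/AnticyclotomicControlGeneral.lean` (`thm331_anticyclotomicControl_general`,
  `splitTamagawaProduct`), `Summits/…/X11b/RouteR1ControlCastella.lean` (the consumer pattern),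
  `Summits/…/X11b/BDPRouteLocalIndex{,Torsion}.lean` (the local index PROVED for every `W`).
* HOME/STATUS.md 2026-08-26T05:34:26Z (imc-p1 TYPER ASK), HOME/HANDOFF.md § bsd-stepL-imc-p1 (REST″
  census), HOME/LIT-DOSSIER.md §2.1–§2.2, §2.7.
-/

noncomputable section

open scoped Classical

open WeierstrassCurve NumberField IsDedekindDomain Field Literature.NumberTheory.EllipticCurves
  Literature.NumberTheory.EllipticCurves.Rank1Residual
  Literature.NumberTheory.EllipticCurves.Castella2018

namespace Literature.NumberTheory.EllipticCurves.JetchevSkinnerWan2017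

/-! ### The named fact: Thm. 3.3.1 + Prop. 3.2.1 + §3.3.3 + (3.5.c) at a multiplicative `p`, `Σ = ∅` -/

/-- **Jetchev–Skinner–Wan, Camb. J. Math. 5 (2017) = arXiv:1512.06894, Theorem 3.3.1 (Anticyclotomic
Control Theorem) [arXiv Thm. 8, p. 11] with Prop. 3.2.1 [Prop. 6], §3.3.3 [Prop. 11] and the §3.5
display (3.5.c) (p. 15), for an elliptic curve `E/ℚ` of ANY conductor `N` at a prime `p ≥ 3` of
MULTIPLICATIVE reduction (`ord_p(N) = 1`, JSW's (p-sst)) split in a general imaginary quadratic `𝒦`,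
`Σ = ∅`; JSW's local index `δ_v` at the multiplicative `p` evaluated as in Castella, Camb. J. Math. 6
(2018) = arXiv:1704.06608, proof of Thm. 2.3, (eq:calcul) (p. 6).** Setting (verbatim, JSW §2.1, §3,
§3.3): "let `p ≥ 3` be a fixed prime"; "`𝒦/ℚ` an imaginary quadratic field such that `p` splits in
`𝒦`: `p = v v̄`"; "`𝒦_∞` the anticyclotomic `ℤ_p`-extension of `𝒦`, `Γ = Gal(𝒦_∞/𝒦)`, `Λ = 𝒪⟦Γ⟧`, `M =
T ⊗_𝒪 Λ^` … `X_ac^Σ(M) = Hom_𝒪(H¹_{𝓕_ac^Σ}(𝒦, M), L/𝒪)`"; "`S` a finite set of places of `𝒦`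
including all those at which `V` is ramified, `S_p ⊂ S` the subset of those not dividing `p`, `Σ ⊂
S_p`. Fix a topological generator `γ ∈ Γ`. We identify `𝒪⟦T⟧` with `Λ` via `1 + T ↦ γ`." Thm. 3.3.1
(verbatim): "The `Λ`-module `X_ac^Σ(M)` is `Λ`-torsion, and if `f_ac^Σ(T)` is a generator of its
characteristic `Λ`-ideal `Ch(X_ac^Σ(M))`, then `#𝒪/f_ac^Σ(0) = #H¹_{𝓕_ac}(𝒦, W) · C^Σ(W)`, where
`C^Σ(W) = #H⁰(𝒦_v, W) · #H⁰(𝒦_v̄, W) · ∏_{w∈S_p∖Σ, w split} #H¹_ur(𝒦_w, W) · ∏_{w∈Σ} #H¹(𝒦_w, W)`",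
proved under §3.1's (geom), (pure), (sst) "`V` is semistable as a representation of `G_{𝒦_w}` for all
`w ∣ p`", (τ-dual), (2-dim), (HT), (irred_𝒦) "`V̄` is an irreducible `κ`-representation of `G_𝒦`",
(corank 1), (sur); Prop. 3.2.1: "`#H¹_{𝓕_ac}(𝒦, W) = #Ш_BK(W/𝒦) · (#δ_v)²`" (Remark 3.2.2(a):
"neither (sst) nor (HT) is used in this proof"); §3.3.3: "`c_w^{(p)}(W) := … = #H¹_ur(𝒦_w, W)` are the
`p`-parts of the local Tamagawa numbers" (nothing at non-split `w`, Case 1(b); trivial at unramified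
split `w`, Case 2(a)). §3.5 (verbatim, p. 15): for `f ∈ S₂(Γ₀(N))` a newform "(geom), (pure), (τ-dual),
and (2-dim) all hold … if (p-sst) `ord_p(N) ≤ 1`, then … (sst) also holds … (HT) always holds for
`2k = 2`"; under (split), (rank 1) `rank_ℤ E(𝒦) = 1`, (Ш 𝔭-finite) `#Ш(E/𝒦)[p^∞] < ∞` ("in this case
`Ш_BK(W_f/𝒦) = Ш(A_f/𝒦)[𝔭^∞]`") and (𝔭-irred) "`A_f[𝔭]` is an irreducible `G_𝒦`-representation"
— which "imply (crk 1), (surj_p), and (irred_𝒦)" — and for `P ∈ E(𝒦)` of infinite order: **(3.5.c)**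
"`#H¹_{𝓕_ac}(𝒦, W_f) = #Ш_BK(W_f/𝒦) · [A_f(𝒦_v)_{/tor} ⊗ 𝒪 : 𝒪·P]² / [A_f(𝒦) ⊗ 𝒪 : 𝒪·P]²`" (the
display BEFORE "Suppose now that (good) `p ∤ N`"). The local index at `p ∣ N` (Castella 2018, proof
of Thm. 2.3, p. 6, verbatim): "The formal group logarithm defines an injective homomorphism
`log_{ω_E} : E(K_𝔭)_{/tor} ⊗ ℤ_p → ℤ_p` mapping `E₁(K_𝔭)` isomorphically onto `pℤ_p` … `E₀(K_𝔭)/E₁(K_𝔭)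
⊗ ℤ_p ≃ Ẽ_ns(𝔽_p) ⊗ ℤ_p`, which is trivial by e.g. [silverman-2] (and `p > 2`) … (eq:calcul)
`[E(K_𝔭)_{/tors} ⊗ ℤ_p : ℤ_p.P] = [E(K_𝔭):E₀(K_𝔭)]_p · #ℤ/(p⁻¹ log_{ω_E} P) / #H⁰(K_𝔭, E[p^∞])`",
(eq:tam-p) "if `w ∣ p`, then `[E(K_𝔭):E₀(K_𝔭)]_p = c_w^{(p)}(E/K)`", (eq:tam-not-p) "if `w ∤ p`, then
`#H¹_ur(K_w, E[p^∞]) = c_w^{(p)}(E/K)` by [skinner-zhang]" — a computation in `E(K_𝔭) = E(ℚ_p)` that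
uses only multiplicative reduction at `p` and `p > 2` (the paper's standing "`E` semistable" is not
invoked; the author applies the resulting Thm. 2.3 to non-semistable `E` in his erratum, Thm. A′:
"does not require the `E` to be semistable … the same argument as in [Cas18, §5]"). Combined at
`Σ = ∅` (the `#H⁰(𝒦_v, W) = #H⁰(𝒦_v̄, W)` cancel; `[E(K_v):E₀(K_v)]_p² = (c_v c_v̄)^{(p)}` joins the
Tamagawa product): `ord_p f_ac(0) = ord_p #Ш(E/𝒦)[p^∞] + 2·((ord_p log_{ω_E} P − 1) − ord_p
[E(𝒦):ℤ·P]) + ord_p ∏_{w ∣ N, w split in 𝒦} c_w(E/𝒦)` — word for word the case `p ∣ N` of Castella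
2018 Thm. 2.3 ("`#ℤ_p/((1 − a_p p⁻¹) log_{ω_E} P)`", `a_p ∈ {±1}`, "`∏_{w∣N⁺} c_w^{(p)}(E/K)`"), i.e. of
the tree's `Castella2018.thm23_anticyclotomicControl`, WITHOUT its standing binder `Semistable W` and
with JSW's (irred_𝒦) in place of "`ρ̄_{E,p}` irreducible over `ℚ`". TRANSCRIBED (module docstring for
the dictionary — identical to `thm331_anticyclotomicControl_general`'s): `W` globally minimal, `3 ≤ p`,
`Mult W p` (nothing assumed at `ℓ ≠ p`); `K` imaginary quadratic with `p` split (nothing assumed at the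
other primes of `N`); (irred_𝒦) = `(W.baseChange K).HasIrreducibleModPGaloisRep p`; `ι : K →+* ℚ_p` and
`v` the prime it induces — the STRICT prime, the log taken on `E(𝒦_v)` (`padicLogOrd W p ι P`); `κ`
anticyclotomic with topological generator `γ`; `X_ac(M) = AcSelmer.XAc (W.baseChange K) p κ v ∅ γ`
(Castella 2018 Def. 2.2, `K_∞`-formulation; flag `JSW-331-Kinf-formulation` as for A174/A178);
`∏_{w∣N, w split} c_w(E/𝒦) = splitTamagawaProduct W K` (the two places above `p` included); conclusion
with `#ℤ_p/(x) = p^{ord_p x}`: torsion, `Ch = (f)`, `f(0) ≠ 0`, `ord_p f(0) = ord_p #Ш(E/𝒦)[p^∞] +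
2·((ord_p log_{ω_E} P − 1) − ord_p[E(𝒦):ℤ·P]) + ord_p (splitTamagawaProduct W K)`. The good-`p`
companion is `thm331_anticyclotomicControl_general`; together they give Castella's two-case statement
for any conductor (`anticyclotomicControl_of_general_of_mult`). PUBLISHED (flag
`JSW331-mult-local-index`: the local-index step is printed inside Castella's proof; the cell PROVES it
for every `W`, `X11b/BDPRouteLocalIndex.lean`).
[cite: JetchevSkinnerWan2017, Thm. 3.3.1 (arXiv:1512.06894 Thm. 8, p. 11) with Prop. 3.2.1 (arXiv Prop. 6, p. 10), Remark 3.2.2 (arXiv Rem. 7, p. 11), §3.3.3 (arXiv Prop. 11, p. 12, Cases 1(a), 1(b), 2(a)), §3.5 (p. 15: (p-sst), (rank 1), (Ш 𝔭-finite), (𝔭-irred), display (3.5.c) preceding (good)), §3.1 (p. 10), §3 (p. 10), §2.1 (p. 6), §2.3.3 (p. 7)]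
[cite: Castella2018, proof of Thm. 2.3 (arXiv:1704.06608 pp. 5–6: (eq:321), (eq:red-p), (eq:calcul), (eq:control-p), (eq:tam-p), (eq:tam-not-p)), Thm. 2.3 case p ∣ N and §2.2 (p. 5), p. 4 (a_p ∈ {±1}), Def. 2.2 (the object X_ac)]
[cite: SilvermanAEC2009, IV.6.4(b), VII.2.1–2.2, VII.6.1 (the filtration E ⊃ E₀ ⊃ E₁ ≅ pℤ_p behind (eq:calcul))] -/
def thm331_anticyclotomicControl_mult : Prop :=
  ∀ (W : WeierstrassCurve ℚ) [W.IsElliptic] [W.IsGloballyMinimal] (p : ℕ) [Fact p.Prime],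
    3 ≤ p → Mult W p →
    ∀ (K : Type) [Field K] [NumberField K], IsImaginaryQuadratic K →
      SatisfiesHeegnerHypothesis p K →
      (W.baseChange K).HasIrreducibleModPGaloisRep p →
    ∀ (ι : K →+* ℚ_[p]) (v : HeightOneSpectrum (𝓞 K)),
      (∀ x : 𝓞 K, x ∈ v.asIdeal ↔ ‖ι (x : K)‖ < 1) →
    ∀ (κ : ZpExtension K p), κ.IsAnticyclotomic →
    ∀ (γ : absoluteGaloisGroup K) [Fact (κ.IsTopGenerator γ)],
      (W.baseChange K).mordellWeilRank = 1 →
      Finite (AddCommGroup.primaryComponent (W.baseChange K).sha p) →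
    ∀ (P : (W.baseChange K).toAffine.Point), ¬ IsOfFinAddOrder P →
      Module.IsTorsion (IwasawaAlgebra p) (AcSelmer.XAc (W.baseChange K) p κ v ∅ γ) ∧
      ∃ F : IwasawaAlgebra p,
        AcSelmer.XAc.charIdeal (W.baseChange K) p κ v ∅ γ = Ideal.span {F} ∧
        PowerSeries.constantCoeff F ≠ 0 ∧
        ((PowerSeries.constantCoeff F).valuation : ℤ) =
          (padicValNat p (Nat.card (AddCommGroup.primaryComponent (W.baseChange K).sha p)) : ℤ) +
            2 * ((padicLogOrd W p ι P - 1) -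
              (padicValNat p (AddSubgroup.zmultiples P).index : ℤ)) +
            (padicValNat p (splitTamagawaProduct W K) : ℤ)

-- TODO(general form): the `Σ`-imprimitive statement of Thm. 3.3.1 at a multiplicative `p` (extra
-- factor `∏_{w∈Σ} #H¹(K_w, E[p^∞])`) and the version for a modular abelian variety `A_f`
-- (`𝒪 = ℤ(f)_𝔭`) — no consumer in the cell.

variable {W : WeierstrassCurve ℚ} [W.IsElliptic] [W.IsGloballyMinimal] {p : ℕ} [Fact p.Prime]

/-! ### Bookkeeping consumers -/

/-- **Thm. 3.3.1 + (3.5.c) at a multiplicative `p`, in the packaged currency**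
`AcSelmer.XAc.HasCharValuationAt … n` ("`X_ac` is `Λ`-torsion with a generator `f`, `f(0) ≠ 0`,
`ord_p f(0) = n`") `∧ n =` the printed right-hand side — literally the body shape of the cell's
Summits-side predicate `X11b.ControlOnTreeAt p κ v γ ι P` ("`ord_p(1 − a_p p⁻¹) = −1`", Tamagawa term
`X11b.tamagawaProductSplit W K`, definitionally `splitTamagawaProduct W K`), for ANY conductor.
[cite: JetchevSkinnerWan2017, Thm. 3.3.1 with §3.5 (3.5.c) (arXiv:1512.06894 pp. 11, 15)]
[cite: Castella2018, proof of Thm. 2.3, (eq:calcul)–(eq:tam-p) (arXiv:1704.06608 p. 6)] -/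
theorem hasCharValuationAt_of_thm331_mult (h : thm331_anticyclotomicControl_mult) (hp : 3 ≤ p)
    (hmult : Mult W p) (K : Type) [Field K] [NumberField K] (hK : IsImaginaryQuadratic K)
    (hHp : SatisfiesHeegnerHypothesis p K)
    (hirrK : (W.baseChange K).HasIrreducibleModPGaloisRep p)
    (ι : K →+* ℚ_[p]) (v : HeightOneSpectrum (𝓞 K))
    (hv : ∀ x : 𝓞 K, x ∈ v.asIdeal ↔ ‖ι (x : K)‖ < 1)
    (κ : ZpExtension K p) (hκ : κ.IsAnticyclotomic)
    (γ : absoluteGaloisGroup K) [Fact (κ.IsTopGenerator γ)]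
    (hrk : (W.baseChange K).mordellWeilRank = 1)
    (hfin : Finite (AddCommGroup.primaryComponent (W.baseChange K).sha p))
    (P : (W.baseChange K).toAffine.Point) (hP : ¬ IsOfFinAddOrder P) :
    ∃ n : ℕ, AcSelmer.XAc.HasCharValuationAt (W.baseChange K) p κ v ∅ γ n ∧
      (n : ℤ) = (padicValNat p (Nat.card (AddCommGroup.primaryComponent (W.baseChange K).sha p)) : ℤ) +
        2 * ((padicLogOrd W p ι P - 1) - (padicValNat p (AddSubgroup.zmultiples P).index : ℤ)) +
        (padicValNat p (splitTamagawaProduct W K) : ℤ) := by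
  obtain ⟨htors, F, hF, hF0, hval⟩ := h W p hp hmult K hK hHp hirrK ι v hv κ hκ γ hrk hfin P hP
  exact ⟨(PowerSeries.constantCoeff F).valuation,
    AcSelmer.XAc.hasCharValuationAt_of_eq htors hF hF0 rfl, hval⟩

/-- **Every generator has the printed valuation** (multiplicative `p`): granted Thm. 3.3.1 + (3.5.c),
if `Ch(X_ac) = (g)` for ANY `g ∈ Λ`, then `g(0) ≠ 0` and `ord_p g(0)` equals the printed right-hand
side (two generators differ by a unit of `Λ`; `AcSelmer.valuation_constantCoeff_eq_of_span_singleton_eq`)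
— the theorem's "if `f_ac^Σ(T)` is a generator". [cite: JetchevSkinnerWan2017, Thm. 3.3.1 (arXiv:1512.06894 Thm. 8, p. 11)] -/
theorem thm331_mult_padicVal_eq_of_generator (h : thm331_anticyclotomicControl_mult)
    (hp : 3 ≤ p) (hmult : Mult W p) (K : Type) [Field K] [NumberField K]
    (hK : IsImaginaryQuadratic K) (hHp : SatisfiesHeegnerHypothesis p K)
    (hirrK : (W.baseChange K).HasIrreducibleModPGaloisRep p)
    (ι : K →+* ℚ_[p]) (v : HeightOneSpectrum (𝓞 K))
    (hv : ∀ x : 𝓞 K, x ∈ v.asIdeal ↔ ‖ι (x : K)‖ < 1)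
    (κ : ZpExtension K p) (hκ : κ.IsAnticyclotomic)
    (γ : absoluteGaloisGroup K) [Fact (κ.IsTopGenerator γ)]
    (hrk : (W.baseChange K).mordellWeilRank = 1)
    (hfin : Finite (AddCommGroup.primaryComponent (W.baseChange K).sha p))
    (P : (W.baseChange K).toAffine.Point) (hP : ¬ IsOfFinAddOrder P)
    (G : IwasawaAlgebra p) (hG : AcSelmer.XAc.charIdeal (W.baseChange K) p κ v ∅ γ = Ideal.span {G}) :
    PowerSeries.constantCoeff G ≠ 0 ∧
      ((PowerSeries.constantCoeff G).valuation : ℤ) =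
        (padicValNat p (Nat.card (AddCommGroup.primaryComponent (W.baseChange K).sha p)) : ℤ) +
          2 * ((padicLogOrd W p ι P - 1) - (padicValNat p (AddSubgroup.zmultiples P).index : ℤ)) +
          (padicValNat p (splitTamagawaProduct W K) : ℤ) := by
  obtain ⟨-, F, hF, hF0, hval⟩ := h W p hp hmult K hK hHp hirrK ι v hv κ hκ γ hrk hfin P hP
  obtain ⟨hG0, hGF⟩ := AcSelmer.valuation_constantCoeff_eq_of_span_singleton_eq (hF.symm.trans hG) hF0
  exact ⟨hG0, by rw [hGF]; exact hval⟩

/-! ### Castella 2018 Thm. 2.3 (both `ε_p`, `Σ = ∅`) for ANY conductor, under (irred_𝒦) -/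

/-- **The two-case anticyclotomic control theorem for any conductor.** Granted the two Jetchev–Skinner–Wan
facts — `thm331_anticyclotomicControl_general` (good `p`) and `thm331_anticyclotomicControl_mult`
(multiplicative `p`) —, at every `E/ℚ` (globally minimal `W`, NO semistability), every `p ≥ 3` with
`ord_p(N) ≤ 1` (`p` good or multiplicative), every imaginary quadratic `K` with `p` split and `E[p]`
irreducible over `G_K`, the conclusion of Castella 2018 Thm. 2.3 at `Σ = ∅` holds VERBATIM in the
tree's two-case transcription (the `if` of `Castella2018.thm23_anticyclotomicControl`: local term
`ord_p(1 − a_p + p) − 1 + ord_p log_{ω_E} P` at a good `p`, `ord_p log_{ω_E} P − 1` at a multiplicative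
`p`). So a consumer written against `thm23`'s conclusion can be fed on non-semistable curves by
supplying (irred_𝒦) instead of `Semistable W ∧ Irr W p`. [cite: JetchevSkinnerWan2017, Thm. 3.3.1 with §3.5 (3.5.c)/(3.5.d) (arXiv:1512.06894 pp. 11, 15–16)]
[cite: Castella2018, Thm. 2.3 (arXiv:1704.06608 p. 5), both cases of ε_p, and its proof (pp. 5–6)] -/
theorem anticyclotomicControl_of_general_of_mult (hg : thm331_anticyclotomicControl_general)
    (hm : thm331_anticyclotomicControl_mult) (hp : 3 ≤ p) (hpN : Good W p ∨ Mult W p)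
    (K : Type) [Field K] [NumberField K] (hK : IsImaginaryQuadratic K)
    (hHp : SatisfiesHeegnerHypothesis p K)
    (hirrK : (W.baseChange K).HasIrreducibleModPGaloisRep p)
    (ι : K →+* ℚ_[p]) (v : HeightOneSpectrum (𝓞 K))
    (hv : ∀ x : 𝓞 K, x ∈ v.asIdeal ↔ ‖ι (x : K)‖ < 1)
    (κ : ZpExtension K p) (hκ : κ.IsAnticyclotomic)
    (γ : absoluteGaloisGroup K) [Fact (κ.IsTopGenerator γ)]
    (hrk : (W.baseChange K).mordellWeilRank = 1)
    (hfin : Finite (AddCommGroup.primaryComponent (W.baseChange K).sha p))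
    (P : (W.baseChange K).toAffine.Point) (hP : ¬ IsOfFinAddOrder P) :
    Module.IsTorsion (IwasawaAlgebra p) (AcSelmer.XAc (W.baseChange K) p κ v ∅ γ) ∧
      ∃ F : IwasawaAlgebra p,
        AcSelmer.XAc.charIdeal (W.baseChange K) p κ v ∅ γ = Ideal.span {F} ∧
        PowerSeries.constantCoeff F ≠ 0 ∧
        ((PowerSeries.constantCoeff F).valuation : ℤ) =
          (padicValNat p (Nat.card (AddCommGroup.primaryComponent (W.baseChange K).sha p)) : ℤ) +
            2 * (((if W.HasGoodReductionAtPrime p then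
                    (padicValInt p (1 - W.frobeniusTrace p + p) : ℤ) else 0) - 1 +
                  padicLogOrd W p ι P) -
              (padicValNat p (AddSubgroup.zmultiples P).index : ℤ)) +
            (padicValNat p (splitTamagawaProduct W K) : ℤ) := by
  rcases hpN with hgood | hmult
  · obtain ⟨htors, F, hF, hF0, hval⟩ := hg W p hp hgood K hK hHp hirrK ι v hv κ hκ γ hrk hfin P hP
    refine ⟨htors, F, hF, hF0, ?_⟩
    rw [hval, if_pos hgood]
  · obtain ⟨htors, F, hF, hF0, hval⟩ := hm W p hp hmult K hK hHp hirrK ι v hv κ hκ γ hrk hfin P hP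
    have hng : ¬ W.HasGoodReductionAtPrime p :=
      fun h ↦ WeierstrassCurve.HasMultiplicativeReduction.not_hasGoodReduction (R := ℤ_[p]) hmult h
    refine ⟨htors, F, hF, hF0, ?_⟩
    rw [hval, if_neg hng]
    ring

/-- **Subsumption of Castella 2018 Thm. 2.3, case `p ∣ N`.** At any datum of
`Castella2018.thm23_anticyclotomicControl_mult` (semistable `W`, `p ≥ 5` multiplicative, `ρ̄_{E,p}`
irreducible over `ℚ`, …) at which (irred_𝒦) is supplied, the conclusion of Castella's theorem follows
from `thm331_anticyclotomicControl_mult` alone (`5 ≤ p ⇒ 3 ≤ p`; the binders `Semistable W`, `Irr W p`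
are simply not used). In print (irred_𝒦) is automatic there (semistable + `p ≥ 5` + irreducible ⇒
`ρ̄_{E,p}` surjective [Serre 1972 Prop. 21, Mazur 1978 Thm. 4]); in the tree it is `irrK_of_surj`
(`Summits/…/Partition/IrreducibleOverQuadraticField.lean`) at a surjective `ρ̄`.
[cite: Castella2018, Thm. 2.3 (arXiv:1704.06608 p. 5), case p ∣ N] [cite: JetchevSkinnerWan2017, Thm. 3.3.1 (arXiv Thm. 8, p. 11), §7.4.1 (p. 30)] -/
theorem thm23_conclusion_mult_of_thm331_mult (h : thm331_anticyclotomicControl_mult)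
    (_hsst : Semistable W) (hp : 5 ≤ p) (_hirr : Irr W p) (hmult : Mult W p)
    (K : Type) [Field K] [NumberField K] (hK : IsImaginaryQuadratic K)
    (hHp : SatisfiesHeegnerHypothesis p K)
    (hirrK : (W.baseChange K).HasIrreducibleModPGaloisRep p)
    (ι : K →+* ℚ_[p]) (v : HeightOneSpectrum (𝓞 K))
    (hv : ∀ x : 𝓞 K, x ∈ v.asIdeal ↔ ‖ι (x : K)‖ < 1)
    (κ : ZpExtension K p) (hκ : κ.IsAnticyclotomic)
    (γ : absoluteGaloisGroup K) [Fact (κ.IsTopGenerator γ)]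
    (hrk : (W.baseChange K).mordellWeilRank = 1)
    (hfin : Finite (AddCommGroup.primaryComponent (W.baseChange K).sha p))
    (P : (W.baseChange K).toAffine.Point) (hP : ¬ IsOfFinAddOrder P) :
    Module.IsTorsion (IwasawaAlgebra p) (AcSelmer.XAc (W.baseChange K) p κ v ∅ γ) ∧
      ∃ F : IwasawaAlgebra p,
        AcSelmer.XAc.charIdeal (W.baseChange K) p κ v ∅ γ = Ideal.span {F} ∧
        PowerSeries.constantCoeff F ≠ 0 ∧
        ((PowerSeries.constantCoeff F).valuation : ℤ) =
          (padicValNat p (Nat.card (AddCommGroup.primaryComponent (W.baseChange K).sha p)) : ℤ) +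
            2 * ((padicLogOrd W p ι P - 1) -
              (padicValNat p (AddSubgroup.zmultiples P).index : ℤ)) +
            (padicValNat p (splitTamagawaProduct W K) : ℤ) :=
  h W p (le_trans (by norm_num) hp) hmult K hK hHp hirrK ι v hv κ hκ γ hrk hfin P hP

end Literature.NumberTheory.EllipticCurves.JetchevSkinnerWan2017

end
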